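import Mathlib.Combinatorics.SetFamily.FourFunctions
import Mathlib.Tactic
import HarnessLib
import HarnessLib.Audit.Tags
import Summits.CriticalPhenomena.PercolationContinuityZ3.Theorems.PercNearOneGluingNoHeavyLowerTailSahiTypeSetDaykinFace
import Summits.CriticalPhenomena.PercolationContinuityZ3.Theorems.PercNearOneGluingNoHeavyLowerTailSahiColouredDaykinCross

/-!
# GOOD COMPRESSION SEQUENCES: the conditional bridge `CrossGoodSequence ⟹ CrossSignedColouredDaykin3`

Support file (seat `prim-masterthm-p1`, gen 43; `--supports stmt-CriticalPhenomena-4575`).  One recursive predicate (`GoodSeq`), one typed conjecture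
(`CrossGoodSequence` = "T_cross" of the memo), two theorems; no `sorry`, standard axioms.
Memo `run/shared/lean/prim/prim-masterthm/FROM-prim-masterthm-p1-g43-TYPE-SETS.md` §8–§9, engines `prim-masterthm-p1/code-g43/c/tcross.c`, `py/psd9.py`.

THE MECHANISM ([this work]).  For a type-set configuration `(G, Z, L)` (`…SahiTypeSetDaykin`) a list of points `y₁, …, y_k` is a GOOD SEQUENCE if at each
step the TWIN INEQUALITY of `…SahiTypeSetDaykinCompress.typeSet_step'` holds for the current configuration at `y_i` (the doubled members pay for the
weight they lose: `Σ_{u ∈ D}(w(L u)+w(L(y+u))) ≤ Σ_{u∈D} w(L' u) + 2·#twins`), the next configuration being the projection with union type-sets, and the FINAL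
configuration contains `∅` — where the face theorem `card_add_card_filter_le_two_mul_card_typeMeets_of_empty_mem` (`…SahiTypeSetDaykinFace`) closes the count.
* `ineq_of_goodSeq` — **a good sequence proves the inequality `#Z + #{self-compatible} ≤ 2·#typeMeets`** for the initial configuration (induction on the
  list: `typeSet_step'` + `projTypes_config` + the face).  No conjecture enters; this is the exact slack bookkeeping `slack(Z) = slack(final) + 2Σ(tw_i − def_i)`.
* `CrossGoodSequence` (typed, [status: open] — "T_cross"): every CROSSING labelled configuration (pairwise meeting, non-covering, cross-label incomparable;
  labels `κ : Finset α → ℕ` with at most the three values `0, 1, 2` — the case the programme needs and the case the census covers) admits a good sequence for its signed family `P ⊔ σP` with the singleton type-sets `signedTypes`.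
  EVIDENCE: ALL 1 720 colour-canonical crossing 3-colour configurations of `2^5` (every ordering of the points of a minimum-size member is good), all
  ≈ 3 500 sampled on `2^6`, 1 200 on `2^7`, 425 on `2^8`, 92 on `2^9` (kit j311420; exhaustive `2^6` in kit j311162/j311180/j311198); the first step is good at
  EVERY point of every crossing configuration (`…SahiCrossFirstStep.crossing_first_step`, given the inequality for the smaller doubled family).
  CAVEAT (memo §3, §8): the analogous statement for GENERAL (non-crossing) configurations is FALSE from `2^5` on (all-bad configurations), and every
  configuration is a deep projection of SOME crossing one — what is conjectured is that good sequences exist FROM crossing starts.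
* `card_le_card_partDiffs_of_crossGoodSequence`, **`crossSignedColouredDaykin3_of_crossGoodSequence : CrossGoodSequence α → CrossSignedColouredDaykin3 α`**
  — the new conditional bridge of the three-petal programme (CrossSCD₃ ⟹ the refined antipodal Gladkov count for three petals, gen 28).
HONEST FRAMING: a reduction to a typed, heavily tested conjecture; nothing is proved about `CrossSignedColouredDaykin3` unconditionally. [this work]
-/

namespace Summit.CriticalPhenomena.PercolationContinuityZ3.Theorems.SahiColouredDaykin

open Finset

variable {α : Type*} [DecidableEq α]

/-- **Good compression sequence** from the type-set configuration `(G, Z, L)`: the empty list is good iff `∅ ∈ Z` (the face); `y :: ys` is good iff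
`y ∈ G`, the twin inequality holds at `y`, and `ys` is good from the projection at `y` (union type-sets). [this work] -/
def GoodSeq : Finset α → Finset (Finset α) → (Finset α → Finset (ℕ × Bool)) → List α → Prop
  | _, Z, _, [] => (∅ : Finset α) ∈ Z
  | G, Z, L, y :: ys =>
      y ∈ G ∧
      (∑ u ∈ bothLifts Z y, (tsWeight (L u) + tsWeight (L (insert y u))) ≤
          ∑ u ∈ bothLifts Z y, tsWeight (projTypes Z L y u) + 2 * #(bothLifts (typeMeets Z L) y)) ∧
      GoodSeq (G.erase y) (Z.image fun s => s.erase y) (projTypes Z L y) ys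

/-- **A good sequence proves the inequality.** [this work] -/
theorem ineq_of_goodSeq : ∀ (ys : List α) (G : Finset α) (Z : Finset (Finset α)) (L : Finset α → Finset (ℕ × Bool)),
    (∀ z ∈ Z, z ⊆ G) → (∀ z ∈ Z, G \ z ∈ Z) → (∀ z ∈ Z, (L z).Nonempty) → (∀ z ∈ Z, L (G \ z) = (L z).image flipT) →
    GoodSeq G Z L ys → #Z + #(Z.filter fun z => lcompat (L z) (L z) = true) ≤ 2 * #(typeMeets Z L)
  | [], G, Z, L, hZG, hcc, hne, hflip, h => by
      exact card_add_card_filter_le_two_mul_card_typeMeets_of_empty_mem hZG hcc hne hflip h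
  | y :: ys, G, Z, L, hZG, hcc, hne, hflip, h => by
      obtain ⟨hy, htw, hrest⟩ := h
      obtain ⟨hZG', hcc', hne', hflip'⟩ := projTypes_config (Z := Z) (L := L) hy hZG hcc hne hflip
      have hIH := ineq_of_goodSeq ys (G.erase y) (Z.image fun s => s.erase y) (projTypes Z L y) hZG' hcc' hne' hflip' hrest
      exact typeSet_step' hIH htw

/-- **CONJECTURE T_cross (typed): every crossing labelled configuration admits a good compression sequence.**  Evidence in the file header.
[this work] [status: open] -/
@[conjecture] def CrossGoodSequence (α : Type*) [DecidableEq α] : Prop :=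
  ∀ (F : Finset α) (P : Finset (Finset α)) (κ : Finset α → ℕ),
    (∀ S ∈ P, S ⊆ F) → (∀ S ∈ P, κ S < 3) →
    (∀ S ∈ P, ∀ T ∈ P, κ S ≠ κ T → ¬ S ⊆ T) →
    (∀ S ∈ P, ∀ T ∈ P, (S ∩ T).Nonempty ∧ S ∪ T ≠ F) →
    ∃ ys : List α, GoodSeq F (P ∪ P.image (fun S => F \ S)) (signedTypes F P κ) ys

/-- `CrossGoodSequence ⟹` the partition-difference inequality for every crossing labelled configuration. [this work] -/
theorem card_le_card_partDiffs_of_crossGoodSequence (h : CrossGoodSequence α) (F : Finset α) (P : Finset (Finset α))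
    (κ : Finset α → ℕ) (hPF : ∀ S ∈ P, S ⊆ F) (hκ : ∀ S ∈ P, κ S < 3) (hinc : ∀ S ∈ P, ∀ T ∈ P, κ S ≠ κ T → ¬ S ⊆ T)
    (hcross : ∀ S ∈ P, ∀ T ∈ P, (S ∩ T).Nonempty ∧ S ∪ T ≠ F) : #P ≤ #(partDiffs F P κ) := by
  have hcf : ∀ S ∈ P, F \ S ∉ P := by
    intro S hS hS'
    have hne := (hcross S hS (F \ S) hS').1
    rw [inter_sdiff_self] at hne
    exact Finset.not_nonempty_empty hne
  obtain ⟨ys, hys⟩ := h F P κ hPF hκ hinc hcross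
  set Z := P ∪ P.image (fun S => F \ S) with hZ
  set L := signedTypes F P κ with hL
  -- the signed family is a configuration with #Z = 2#P (as in `partitionSignedDaykin_of_typeSetSignedDaykin`)
  have hZG : ∀ z ∈ Z, z ⊆ F := by
    intro z hz
    rcases mem_union_image_sdiff_iff.1 hz with hzP | ⟨S, _, rfl⟩
    · exact hPF z hzP
    · exact sdiff_subset
  have hcc : ∀ z ∈ Z, F \ z ∈ Z := by
    intro z hz
    rcases mem_union_image_sdiff_iff.1 hz with hzP | ⟨S, hS, rfl⟩
    · exact mem_union.2 (Or.inr (mem_image.2 ⟨z, hzP, rfl⟩))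
    · rw [Finset.sdiff_sdiff_eq_self (hPF S hS)]; exact mem_union.2 (Or.inl hS)
  have hne : ∀ z ∈ Z, (L z).Nonempty := by
    intro z hz
    rcases mem_union_image_sdiff_iff.1 hz with hzP | ⟨S, hS, rfl⟩
    · rw [hL, signedTypes_of_mem hcf hzP]; exact singleton_nonempty _
    · rw [hL, signedTypes_of_sdiff_mem hPF hcf hS]; exact singleton_nonempty _
  have hflip : ∀ z ∈ Z, L (F \ z) = (L z).image flipT := by
    intro z hz
    rcases mem_union_image_sdiff_iff.1 hz with hzP | ⟨S, hS, rfl⟩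
    · rw [hL, signedTypes_of_mem hcf hzP, signedTypes_of_sdiff_mem hPF hcf hzP, image_singleton]; rfl
    · rw [hL, Finset.sdiff_sdiff_eq_self (hPF S hS), signedTypes_of_mem hcf hS, signedTypes_of_sdiff_mem hPF hcf hS,
        image_singleton]
      simp [flipT]
  have key := ineq_of_goodSeq ys F Z L hZG hcc hne hflip hys
  have hdisj : Disjoint P (P.image fun S => F \ S) := by
    rw [disjoint_left]
    intro S hS hSN
    obtain ⟨S', hS', hSS'⟩ := mem_image.1 hSN
    exact hcf S' hS' (hSS' ▸ hS)
  have hinj : Set.InjOn (fun S => F \ S) ↑P := by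
    intro S hS S' hS' hSS'
    have h1 := hPF S (mem_coe.1 hS); have h2 := hPF S' (mem_coe.1 hS')
    have : F \ (F \ S) = F \ (F \ S') := by simp only at hSS'; rw [hSS']
    rwa [Finset.sdiff_sdiff_eq_self h1, Finset.sdiff_sdiff_eq_self h2] at this
  have hcardZ : #Z = 2 * #P := by
    rw [hZ, card_union_of_disjoint hdisj, card_image_of_injOn hinj]; ring
  have hsub := card_le_card (typeMeets_signed_subset_partDiffs (κ := κ) hPF hcf)
  have : 2 * #P ≤ 2 * #(partDiffs F P κ) :=
    calc 2 * #P = #Z := hcardZ.symm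
      _ ≤ #Z + #(Z.filter fun z => lcompat (L z) (L z) = true) := Nat.le_add_right _ _
      _ ≤ 2 * #(typeMeets Z L) := key
      _ ≤ 2 * #(partDiffs F P κ) := Nat.mul_le_mul_left 2 hsub
  omega

/-- **THE CONDITIONAL BRIDGE: `CrossGoodSequence ⟹ CrossSignedColouredDaykin3`** (hence, by gen 28's `card_crossPairs₃_le_card_payPairs₃_of_cross`, the
refined antipodal Gladkov count for every 3-petal system of up-sets in every sub-cube). [this work] -/
theorem crossSignedColouredDaykin3_of_crossGoodSequence (h : CrossGoodSequence α) : CrossSignedColouredDaykin3 α := by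
  intro F P c hPF hinc hcross
  have hinc' : ∀ S ∈ P, ∀ T ∈ P, ((c S : ℕ)) ≠ (c T : ℕ) → ¬ S ⊆ T :=
    fun S hS T hT hne => hinc S hS T hT (fun h => hne (by rw [h]))
  have hκ : ∀ S ∈ P, ((c S : ℕ)) < 3 := fun S _ => (c S).isLt
  have := card_le_card_partDiffs_of_crossGoodSequence h F P (fun S => ((c S : ℕ))) hPF hκ hinc' hcross
  rw [partDiffs_val_eq_admDiffs] at this
  exact this.trans (card_admDiffs_le_card_compatJoins hPF)

end Summit.CriticalPhenomena.PercolationContinuityZ3.Theorems.SahiColouredDaykin
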